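import Summits.ABC.IUTFork.Conditional.AbcOfSGenuineMLinUniformBand
import Summits.ABC.IUTFork.Conditional.AbcOfSGenuineKLinUniformRows4
import HarnessLib

/-!
# M LINE: R-W table rows (block F3) DECIDED on the refuted side, UNIFORMLY IN `l`, by [LIN]-uniform BAND theorems — part 4 (M twins of `…LinUniformBandRows4`)
# (triples: 11 * 103 ^ 8 + 2 ^ 45 * 3 ^ 7 * 29 * 37 * 1997 = 5 ^ 11 * 7 ^ 10 * 79 * 389 ^ 2, 29 ^ 4 * 2213 ^ 2 + 3 * 13 ^ 2 * 23 ^ 12 * 89 * 14717 = 2 ^ 9 * 5 ^ 16 * 11 ^ 9 * 79, 3 ^ 5 * 5 ^ 15 * 13 ^ 5 + 7 ^ 10 * 79 ^ 5 * 35323 = 2 ^ 11 * 73 ^ 7 * 83 ^ 2 * 197, 5 ^ 14 * 19 + 2 ^ 5 * 3 * 7 ^ 13 = 11 ^ 7 * 37 ^ 2 * 353)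

PROOF-ONLY file (no `def`, no new `Prop`, no instance) of the abc-iut cell (D-0079 R-W numerics crew seat abc-iut-W-num-6, gen 2; row «W:F3-LINU-BANDS»).
TAKES NO SIDE on [IUTchIII] Cor. 3.12 or on any author. ONE THEOREM PER KNOWN abc TRIPLE, M LINE: this seat's band certificate form
`GenuineM.not_pilotKummerCompatHull_triple_of_linUniform_cert` (`AbcOfSGenuineMLinUniformBand`) of abc-iut-w5-d107's M-line e-free [LIN]-uniform decider p466242 is
instantiated with ONE deciding prime `p ∉ {2,3,5}` of the triple and a short chain of bands `B` (case split on `l ≤ ⌊(p^B(p−1)−1)/30⌋`); every integer side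
condition is a closed numeral checked by `norm_num`, the band membership by `omega`. Each theorem `…_frey<a>_p<p>_band {l} (hl : l.Prime) (hlo : L₀ ≤ l) (hhi : l ≤ L₁) [(hneP : l ≠ p)] (T) (u : FinitePlace ℚ) (hu : ratChar u = p)`
decides, for EVERY prime `l` in its range (not only the tabulated `l ≤ 397` of the R-W numerics lead's WINDOW-TABLE block F3 / TE30-CENSUS) and EVERY genuine
Θ-volume datum `T` over `(ratPoint (a/c), l)`, that the hull-level clause S_H at the summand-route M-level sharp setting of `T`'s OWN read-off ideles (pinned reading — the per-datum object of the M window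
binder of `abc_of_SH_v11M_window`) FAILS for every choice of the free context binders and Kummer datum. The `IsABCTriple` facts are the tree's (abc-iut-w5-d107 / W-ref lineages), BY NAME.
Machine list of the (triple, l) rows: HOME/abc-iut-W-num-6/bands/BAND-ROWS-M.tsv (K list BAND-ROWS.tsv). NOT claimed: admissibility / Szpiro-badness / (P6) of `(ratPoint (a/c), l)`,
non-emptiness of the datum type. HONEST SCOPE as in the parents: SHARP reading; per-label licence STRONGER than print; «refuted as typed» ≠ «refuted in print»;
nothing about the number-level Corollary; typed ≠ proved; instantiated ≠ endorsed. [cite: Mochizuki2012, IUTchIII Cor. 3.12 Step (xi-f) p. 184; IUTchIV Prop. 1.2 p. 10,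
Cor. 2.2 (ii) proof p. 44] [cite: MochizukiGenEll2010, Thm. 2.1 p. 11] [claim: Mochizuki2012, status: disputed] for every IUT sentence quoted.
-/

noncomputable section

open Set Function NumberField IsDedekindDomain

namespace Summit.ABC.IUTFork.Conditional

open Thm311 Thm311.Real Cor312 Cor312Vol Cor312Prov Literature.IUT.LogThetaLattice Literature.IUT.LogVolume
  Literature.IUT.HodgeTheaters Literature.IUT.LogVolume.ThetaData Literature.IUT.LogVolume.Cor22
open Literature.NumberTheory.NumberFields Literature.NumberTheory.GaloisRepresentations.Ultrametric
open Literature.NumberTheory.DiophantineGeometry Literature.NumberTheory.DiophantineGeometry.GenEll Summit.ABC.ABC.Theorems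

/-- **M LINE — R-W ROWS `pilotDataOfK:frey-139344708952637771-164883187567419514159104-164883326912128466796875:l` for EVERY prime `7 ≤ l ≤ 36070`
with `l ≠ 103` — REFUTED side at the M setting, unconditionally, BY ONE BAND THEOREM** (M twin of
`GenuineK.not_pilotKummerCompatHull_chosen_frey139344708952637771_band`; deciding place `u` over `p = 103`) (block F3 of the R-W numerics lead's
WINDOW-TABLE: 71 tabulated Szpiro-bad admissible `l` of this triple, `13 ≤ l ≤ 397`): triple `11 * 103 ^ 8 + 2 ^ 45 * 3 ^ 7 * 29 * 37 * 1997 = 5 ^ 11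
* 7 ^ 10 * 79 * 389 ^ 2`; deciding prime `p = 103` (`103^8 ∣ abc`, `p ∤ 30`), bands `B = 1` for `l ≤ 350` (certificate `l₀ = 7`); `B = 2` for `l ≤
36070` (certificate `l₀ = 15`); `l = 103` excluded (`p = l` is outside the decider): at the label `j = l⋆ = (l−1)/2` the [LIN]-uniform test of p464182
holds throughout the band (quadratic certificate `LinUniformBand.test_of_cert`), so the hull-level clause S_H FAILS at the summand-route M-level sharp
setting of the OWN read-off ideles (pinned reading) of every genuine Θ-volume datum over `(ratPoint (a/c), l)` for every choice of the free context
binders and Kummer datum. NOT claimed: admissibility / Szpiro-badness / (P6) / non-emptiness. [cite: Mochizuki2012, IUTchIII Cor. 3.12 Step (xi-f) p.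
184; IUTchIV Prop. 1.2 p. 10] [claim: Mochizuki2012, status: disputed] -/
theorem GenuineM.not_pilotKummerCompatHull_frey139344708952637771_p103_band {l : ℕ} (hl : l.Prime) (hlo : 7 ≤ l) (hhi : l ≤ 36070) (hneP : l ≠ 103)
    (T : Cor22.ThetaVolumeDatumAt (ratPoint (((11 * 103 ^ 8 : ℕ) : ℚ) / (5 ^ 11 * 7 ^ 10 * 79 * 389 ^ 2 : ℕ))) l) (u : FinitePlace ℚ) (hu : ratChar u = 103) :
    letI := T.instFieldF; letI := T.instNumberFieldF; letI := T.instAlgebraF; letI := T.instFieldK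
    letI := T.instNumberFieldK; letI := T.instAlgebraK; letI := T.instFieldFbar; letI := T.instAlgebraFbar
    letI := T.instAlgebraKFbar; letI := T.instIsElliptic
    ∀ (M : Type) [Field M] [NumberField M]
      (archPk : ∀ (j : (thetaIndexOfInitial T.D).Label) (vQ : (thetaIndexOfInitial T.D).VQ),
        Set ((logShellsOfInitialDH T.D (analyticLogvVal T.K)).Packet j vQ))
      (archSub : ∀ (j : (thetaIndexOfInitial T.D).Label) (v : (thetaIndexOfInitial T.D).V),
        Set ((logShellsOfInitialDH T.D (analyticLogvVal T.K)).Packet j ((thetaIndexOfInitial T.D).over v)))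
      (Ψ : ℤ → ∀ v : (thetaIndexOfInitial T.D).V, v ∈ (thetaIndexOfInitial T.D).Vbad →
        Set ((logShellsOfInitialDH T.D (analyticLogvVal T.K)).StarPacket v))
      (act : ℤ → ∀ v : (thetaIndexOfInitial T.D).V, v ∈ (thetaIndexOfInitial T.D).Vbad →
        (logShellsOfInitialDH T.D (analyticLogvVal T.K)).StarPacket v →
          Module.End ℚ ((logShellsOfInitialDH T.D (analyticLogvVal T.K)).StarPacket v))
      (Mmod : ℤ → ∀ j : (thetaIndexOfInitial T.D).LabelStar, Set ((logShellsOfInitialDH T.D (analyticLogvVal T.K)).GlobalPacket j.1))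
      (region : ℤ → ∀ j : (thetaIndexOfInitial T.D).LabelStar, FinDivisor M → ∀ vQ : (thetaIndexOfInitial T.D).VQ,
        Set ((logShellsOfInitialDH T.D (analyticLogvVal T.K)).Packet j.1 vQ))
      (frobAdm : ℤ → ℤ → ∀ (j : (thetaIndexOfInitial T.D).Label) (vQ : (thetaIndexOfInitial T.D).VQ),
        Set ((logShellsOfInitialDH T.D (analyticLogvVal T.K)).Packet j vQ) → Prop)
      (frobLogvol : ℤ → ℤ → ∀ (j : (thetaIndexOfInitial T.D).Label) (vQ : (thetaIndexOfInitial T.D).VQ),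
        Set ((logShellsOfInitialDH T.D (analyticLogvVal T.K)).Packet j vQ) → ℝ)
      (frobΨ : ℤ → ℤ → ∀ v : (thetaIndexOfInitial T.D).V, v ∈ (thetaIndexOfInitial T.D).Vbad →
        Set ((logShellsOfInitialDH T.D (analyticLogvVal T.K)).StarPacket v))
      (frobMmod : ℤ → ℤ → ∀ j : (thetaIndexOfInitial T.D).LabelStar, Set ((logShellsOfInitialDH T.D (analyticLogvVal T.K)).GlobalPacket j.1))
      (unitImage : ℤ → ℤ → ℕ → ∀ (j : (thetaIndexOfInitial T.D).Label) (vQ : (thetaIndexOfInitial T.D).VQ),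
        Set ((logShellsOfInitialDH T.D (analyticLogvVal T.K)).Packet j vQ))
      (ballImage : ℤ → ℤ → ∀ (j : (thetaIndexOfInitial T.D).Label) (vQ : (thetaIndexOfInitial T.D).VQ),
        Set ((logShellsOfInitialDH T.D (analyticLogvVal T.K)).Packet j vQ))
      (thetaDiv : ℤ → ℤ → LgpDivisor M (thetaIndexOfInitial T.D).lstar)
      (n : ℤ) {HT : Type} {LogLink : HT → HT → Type} {IsFull : ∀ {s t : HT}, LogLink s t → Prop}
      (lat : LGPGaussianLogThetaLattice LogLink IsFull)
      {Frd : Type} {IsoF : Frd → Frd → Type} {Ob : Frd → Type} {realify : Frd → Frd} {Strip : Type}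
      {IsoS : Strip → Strip → Type} {Mv : ∀ v : (thetaIndexOfInitial T.D).V, v ∈ (thetaIndexOfInitial T.D).Vbad → Type}
      [∀ v h, Monoid (Mv v h)]
      (sig : GlobalLGPFrobenioidSignature (thetaIndexOfInitial T.D).lstar (thetaIndexOfInitial T.D).V
        (· ∈ (thetaIndexOfInitial T.D).Vbad) Frd IsoF Ob realify Strip IsoS Mv)
      (split : SplittingMonoids Mv) {ObΔ : Type} {N : ∀ v : (thetaIndexOfInitial T.D).V, v ∈ (thetaIndexOfInitial T.D).Vbad → Type}
      [∀ v h, Monoid (N v h)] (qData : QPilotData ObΔ N)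
      (qK : ∀ v : (thetaIndexOfInitial T.D).V, v ∈ (thetaIndexOfInitial T.D).Vbad →
        Set ((logShellsOfInitialDH T.D (analyticLogvVal T.K)).StarPacket v)),
      ¬ Cor312Vol.PilotKummerCompatHull
        (LatticeSituation.ofShells (logShellsOfInitialDH T.D (analyticLogvVal T.K)) M archPk archSub
          (summandPiecesPrM T.D (logvAnalyticVal_analyticLogvVal (K := T.K))).Adm (summandPiecesPrM T.D (logvAnalyticVal_analyticLogvVal (K := T.K))).logvol Ψ act Mmod region frobAdm frobLogvol
          frobΨ frobMmod unitImage ballImage thetaDiv)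
        (settingPrVolSharpM T.D (logvAnalyticVal_analyticLogvVal (K := T.K)) (tOfIdeleData T.D (ideleDataOf T.D T.isVolumeInputOf))
          (fun u x => tqM T.D (ratChar u) u (natCast_ratChar_mem u) (ideleDataOf T.D T.isVolumeInputOf) x) M archPk archSub Ψ act Mmod region n lat sig split qData
          (fun u x => tqM_ne_zero T.D (ratChar u) u (natCast_ratChar_mem u) (ideleDataOf T.D T.isVolumeInputOf) x)
          (GenuineM.finite_ratPlaces_under_S T.D).toFinset
          (fun u x hu => norm_tqM_eq_one_of_not_mem T.D (ratChar u) u (natCast_ratChar_mem u) (ideleDataOf T.D T.isVolumeInputOf) x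
            fun hx => hu ((Set.Finite.mem_toFinset _).mpr ⟨x, hx⟩)))
        (fun _ => Cor312.Setting.qRegion
          (settingPrVolSharpM T.D (logvAnalyticVal_analyticLogvVal (K := T.K)) (tOfIdeleData T.D (ideleDataOf T.D T.isVolumeInputOf))
          (fun u x => tqM T.D (ratChar u) u (natCast_ratChar_mem u) (ideleDataOf T.D T.isVolumeInputOf) x) M archPk archSub Ψ act Mmod region n lat sig split qData
          (fun u x => tqM_ne_zero T.D (ratChar u) u (natCast_ratChar_mem u) (ideleDataOf T.D T.isVolumeInputOf) x)
          (GenuineM.finite_ratPlaces_under_S T.D).toFinset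
          (fun u x hu => norm_tqM_eq_one_of_not_mem T.D (ratChar u) u (natCast_ratChar_mem u) (ideleDataOf T.D T.isVolumeInputOf) x
            fun hx => hu ((Set.Finite.mem_toFinset _).mpr ⟨x, hx⟩)))) qK := by
  rcases Nat.lt_or_ge l 351 with hlt0 | hge0
  · exact GenuineM.not_pilotKummerCompatHull_triple_of_linUniform_cert isABCTriple_frey139344708952637771 T u 103 hu (by norm_num) (by norm_num)
      (by norm_num) hneP.symm 1 (by show 30 * l < 103 ^ 1 * (103 - 1); norm_num; omega) 8 (by norm_num) (dvd_mul_of_dvd_left (dvd_mul_of_dvd_left (by norm_num) _) _) hl (by omega) 7 (by omega)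
      (by norm_num) (by norm_num) (by norm_num)
  exact GenuineM.not_pilotKummerCompatHull_triple_of_linUniform_cert isABCTriple_frey139344708952637771 T u 103 hu (by norm_num) (by norm_num)
      (by norm_num) hneP.symm 2 (by show 30 * l < 103 ^ 2 * (103 - 1); norm_num; omega) 8 (by norm_num) (dvd_mul_of_dvd_left (dvd_mul_of_dvd_left (by norm_num) _) _) hl (by omega) 15 (by omega)
      (by norm_num) (by norm_num) (by norm_num)

/-- **M LINE — R-W ROWS `pilotDataOfK:frey-3463816043689-14552958405387161183956311-14552958405390625000000000:l` for EVERY prime `5 ≤ l ≤ 205216`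
with `l ≠ 23` — REFUTED side at the M setting, unconditionally, BY ONE BAND THEOREM** (M twin of
`GenuineK.not_pilotKummerCompatHull_chosen_frey3463816043689_band`; deciding place `u` over `p = 23`) (block F3 of the R-W numerics lead's
WINDOW-TABLE: 72 tabulated Szpiro-bad admissible `l` of this triple, `13 ≤ l ≤ 397`): triple `29 ^ 4 * 2213 ^ 2 + 3 * 13 ^ 2 * 23 ^ 12 * 89 * 14717 =
2 ^ 9 * 5 ^ 16 * 11 ^ 9 * 79`; deciding prime `p = 23` (`23^12 ∣ abc`, `p ∤ 30`), bands `B = 1` for `l ≤ 16` (certificate `l₀ = 5`); `B = 2` for `l ≤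
387` (certificate `l₀ = 7`); `B = 3` for `l ≤ 8922` (certificate `l₀ = 11`); `B = 4` for `l ≤ 205216` (certificate `l₀ = 21`); `l = 23` excluded on
the M line (one place `u` over `p`; the K twin decides it by `p' = 11`): at the label `j = l⋆ = (l−1)/2` the [LIN]-uniform test of p464182 holds
throughout the band (quadratic certificate `LinUniformBand.test_of_cert`), so the hull-level clause S_H FAILS at the summand-route M-level sharp
setting of the OWN read-off ideles (pinned reading) of every genuine Θ-volume datum over `(ratPoint (a/c), l)` for every choice of the free context
binders and Kummer datum. NOT claimed: admissibility / Szpiro-badness / (P6) / non-emptiness. [cite: Mochizuki2012, IUTchIII Cor. 3.12 Step (xi-f) p.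
184; IUTchIV Prop. 1.2 p. 10] [claim: Mochizuki2012, status: disputed] -/
theorem GenuineM.not_pilotKummerCompatHull_frey3463816043689_p23_band {l : ℕ} (hl : l.Prime) (hlo : 5 ≤ l) (hhi : l ≤ 205216) (hneP : l ≠ 23)
    (T : Cor22.ThetaVolumeDatumAt (ratPoint (((29 ^ 4 * 2213 ^ 2 : ℕ) : ℚ) / (2 ^ 9 * 5 ^ 16 * 11 ^ 9 * 79 : ℕ))) l) (u : FinitePlace ℚ) (hu : ratChar u = 23) :
    letI := T.instFieldF; letI := T.instNumberFieldF; letI := T.instAlgebraF; letI := T.instFieldK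
    letI := T.instNumberFieldK; letI := T.instAlgebraK; letI := T.instFieldFbar; letI := T.instAlgebraFbar
    letI := T.instAlgebraKFbar; letI := T.instIsElliptic
    ∀ (M : Type) [Field M] [NumberField M]
      (archPk : ∀ (j : (thetaIndexOfInitial T.D).Label) (vQ : (thetaIndexOfInitial T.D).VQ),
        Set ((logShellsOfInitialDH T.D (analyticLogvVal T.K)).Packet j vQ))
      (archSub : ∀ (j : (thetaIndexOfInitial T.D).Label) (v : (thetaIndexOfInitial T.D).V),
        Set ((logShellsOfInitialDH T.D (analyticLogvVal T.K)).Packet j ((thetaIndexOfInitial T.D).over v)))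
      (Ψ : ℤ → ∀ v : (thetaIndexOfInitial T.D).V, v ∈ (thetaIndexOfInitial T.D).Vbad →
        Set ((logShellsOfInitialDH T.D (analyticLogvVal T.K)).StarPacket v))
      (act : ℤ → ∀ v : (thetaIndexOfInitial T.D).V, v ∈ (thetaIndexOfInitial T.D).Vbad →
        (logShellsOfInitialDH T.D (analyticLogvVal T.K)).StarPacket v →
          Module.End ℚ ((logShellsOfInitialDH T.D (analyticLogvVal T.K)).StarPacket v))
      (Mmod : ℤ → ∀ j : (thetaIndexOfInitial T.D).LabelStar, Set ((logShellsOfInitialDH T.D (analyticLogvVal T.K)).GlobalPacket j.1))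
      (region : ℤ → ∀ j : (thetaIndexOfInitial T.D).LabelStar, FinDivisor M → ∀ vQ : (thetaIndexOfInitial T.D).VQ,
        Set ((logShellsOfInitialDH T.D (analyticLogvVal T.K)).Packet j.1 vQ))
      (frobAdm : ℤ → ℤ → ∀ (j : (thetaIndexOfInitial T.D).Label) (vQ : (thetaIndexOfInitial T.D).VQ),
        Set ((logShellsOfInitialDH T.D (analyticLogvVal T.K)).Packet j vQ) → Prop)
      (frobLogvol : ℤ → ℤ → ∀ (j : (thetaIndexOfInitial T.D).Label) (vQ : (thetaIndexOfInitial T.D).VQ),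
        Set ((logShellsOfInitialDH T.D (analyticLogvVal T.K)).Packet j vQ) → ℝ)
      (frobΨ : ℤ → ℤ → ∀ v : (thetaIndexOfInitial T.D).V, v ∈ (thetaIndexOfInitial T.D).Vbad →
        Set ((logShellsOfInitialDH T.D (analyticLogvVal T.K)).StarPacket v))
      (frobMmod : ℤ → ℤ → ∀ j : (thetaIndexOfInitial T.D).LabelStar, Set ((logShellsOfInitialDH T.D (analyticLogvVal T.K)).GlobalPacket j.1))
      (unitImage : ℤ → ℤ → ℕ → ∀ (j : (thetaIndexOfInitial T.D).Label) (vQ : (thetaIndexOfInitial T.D).VQ),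
        Set ((logShellsOfInitialDH T.D (analyticLogvVal T.K)).Packet j vQ))
      (ballImage : ℤ → ℤ → ∀ (j : (thetaIndexOfInitial T.D).Label) (vQ : (thetaIndexOfInitial T.D).VQ),
        Set ((logShellsOfInitialDH T.D (analyticLogvVal T.K)).Packet j vQ))
      (thetaDiv : ℤ → ℤ → LgpDivisor M (thetaIndexOfInitial T.D).lstar)
      (n : ℤ) {HT : Type} {LogLink : HT → HT → Type} {IsFull : ∀ {s t : HT}, LogLink s t → Prop}
      (lat : LGPGaussianLogThetaLattice LogLink IsFull)
      {Frd : Type} {IsoF : Frd → Frd → Type} {Ob : Frd → Type} {realify : Frd → Frd} {Strip : Type}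
      {IsoS : Strip → Strip → Type} {Mv : ∀ v : (thetaIndexOfInitial T.D).V, v ∈ (thetaIndexOfInitial T.D).Vbad → Type}
      [∀ v h, Monoid (Mv v h)]
      (sig : GlobalLGPFrobenioidSignature (thetaIndexOfInitial T.D).lstar (thetaIndexOfInitial T.D).V
        (· ∈ (thetaIndexOfInitial T.D).Vbad) Frd IsoF Ob realify Strip IsoS Mv)
      (split : SplittingMonoids Mv) {ObΔ : Type} {N : ∀ v : (thetaIndexOfInitial T.D).V, v ∈ (thetaIndexOfInitial T.D).Vbad → Type}
      [∀ v h, Monoid (N v h)] (qData : QPilotData ObΔ N)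
      (qK : ∀ v : (thetaIndexOfInitial T.D).V, v ∈ (thetaIndexOfInitial T.D).Vbad →
        Set ((logShellsOfInitialDH T.D (analyticLogvVal T.K)).StarPacket v)),
      ¬ Cor312Vol.PilotKummerCompatHull
        (LatticeSituation.ofShells (logShellsOfInitialDH T.D (analyticLogvVal T.K)) M archPk archSub
          (summandPiecesPrM T.D (logvAnalyticVal_analyticLogvVal (K := T.K))).Adm (summandPiecesPrM T.D (logvAnalyticVal_analyticLogvVal (K := T.K))).logvol Ψ act Mmod region frobAdm frobLogvol
          frobΨ frobMmod unitImage ballImage thetaDiv)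
        (settingPrVolSharpM T.D (logvAnalyticVal_analyticLogvVal (K := T.K)) (tOfIdeleData T.D (ideleDataOf T.D T.isVolumeInputOf))
          (fun u x => tqM T.D (ratChar u) u (natCast_ratChar_mem u) (ideleDataOf T.D T.isVolumeInputOf) x) M archPk archSub Ψ act Mmod region n lat sig split qData
          (fun u x => tqM_ne_zero T.D (ratChar u) u (natCast_ratChar_mem u) (ideleDataOf T.D T.isVolumeInputOf) x)
          (GenuineM.finite_ratPlaces_under_S T.D).toFinset
          (fun u x hu => norm_tqM_eq_one_of_not_mem T.D (ratChar u) u (natCast_ratChar_mem u) (ideleDataOf T.D T.isVolumeInputOf) x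
            fun hx => hu ((Set.Finite.mem_toFinset _).mpr ⟨x, hx⟩)))
        (fun _ => Cor312.Setting.qRegion
          (settingPrVolSharpM T.D (logvAnalyticVal_analyticLogvVal (K := T.K)) (tOfIdeleData T.D (ideleDataOf T.D T.isVolumeInputOf))
          (fun u x => tqM T.D (ratChar u) u (natCast_ratChar_mem u) (ideleDataOf T.D T.isVolumeInputOf) x) M archPk archSub Ψ act Mmod region n lat sig split qData
          (fun u x => tqM_ne_zero T.D (ratChar u) u (natCast_ratChar_mem u) (ideleDataOf T.D T.isVolumeInputOf) x)
          (GenuineM.finite_ratPlaces_under_S T.D).toFinset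
          (fun u x hu => norm_tqM_eq_one_of_not_mem T.D (ratChar u) u (natCast_ratChar_mem u) (ideleDataOf T.D T.isVolumeInputOf) x
            fun hx => hu ((Set.Finite.mem_toFinset _).mpr ⟨x, hx⟩)))) qK := by
  rcases Nat.lt_or_ge l 17 with hlt0 | hge0
  · exact GenuineM.not_pilotKummerCompatHull_triple_of_linUniform_cert isABCTriple_frey3463816043689 T u 23 hu (by norm_num) (by norm_num)
      (by norm_num) hneP.symm 1 (by show 30 * l < 23 ^ 1 * (23 - 1); norm_num; omega) 12 (by norm_num) (dvd_mul_of_dvd_left (dvd_mul_of_dvd_right (by norm_num) _) _) hl (by omega) 5 (by omega)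
      (by norm_num) (by norm_num) (by norm_num)
  rcases Nat.lt_or_ge l 388 with hlt1 | hge1
  · exact GenuineM.not_pilotKummerCompatHull_triple_of_linUniform_cert isABCTriple_frey3463816043689 T u 23 hu (by norm_num) (by norm_num)
      (by norm_num) hneP.symm 2 (by show 30 * l < 23 ^ 2 * (23 - 1); norm_num; omega) 12 (by norm_num) (dvd_mul_of_dvd_left (dvd_mul_of_dvd_right (by norm_num) _) _) hl (by omega) 7 (by omega)
      (by norm_num) (by norm_num) (by norm_num)
  rcases Nat.lt_or_ge l 8923 with hlt2 | hge2
  · exact GenuineM.not_pilotKummerCompatHull_triple_of_linUniform_cert isABCTriple_frey3463816043689 T u 23 hu (by norm_num) (by norm_num)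
      (by norm_num) hneP.symm 3 (by show 30 * l < 23 ^ 3 * (23 - 1); norm_num; omega) 12 (by norm_num) (dvd_mul_of_dvd_left (dvd_mul_of_dvd_right (by norm_num) _) _) hl (by omega) 11 (by omega)
      (by norm_num) (by norm_num) (by norm_num)
  exact GenuineM.not_pilotKummerCompatHull_triple_of_linUniform_cert isABCTriple_frey3463816043689 T u 23 hu (by norm_num) (by norm_num)
      (by norm_num) hneP.symm 4 (by show 30 * l < 23 ^ 4 * (23 - 1); norm_num; omega) 12 (by norm_num) (dvd_mul_of_dvd_left (dvd_mul_of_dvd_right (by norm_num) _) _) hl (by omega) 21 (by omega)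
      (by norm_num) (by norm_num) (by norm_num)

/-- **M LINE — R-W ROWS `pilotDataOfK:frey-2753424041748046875-30702478641325637862373-30705232065367385909248:l` for EVERY prime `9 ≤ l ≤ 12789` with
`l ≠ 73` — REFUTED side at the M setting, unconditionally, BY ONE BAND THEOREM** (M twin of
`GenuineK.not_pilotKummerCompatHull_chosen_frey2753424041748046875_band`; deciding place `u` over `p = 73`) (block F3 of the R-W numerics lead's
WINDOW-TABLE: 74 tabulated Szpiro-bad admissible `l` of this triple, `11 ≤ l ≤ 397`): triple `3 ^ 5 * 5 ^ 15 * 13 ^ 5 + 7 ^ 10 * 79 ^ 5 * 35323 = 2 ^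
11 * 73 ^ 7 * 83 ^ 2 * 197`; deciding prime `p = 73` (`73^7 ∣ abc`, `p ∤ 30`), bands `B = 1` for `l ≤ 175` (certificate `l₀ = 9`); `B = 2` for `l ≤
12789` (certificate `l₀ = 26`); `l = 73` excluded on the M line (one place `u` over `p`; the K twin decides it by `p' = 79`): at the label `j = l⋆ =
(l−1)/2` the [LIN]-uniform test of p464182 holds throughout the band (quadratic certificate `LinUniformBand.test_of_cert`), so the hull-level clause
S_H FAILS at the summand-route M-level sharp setting of the OWN read-off ideles (pinned reading) of every genuine Θ-volume datum over `(ratPoint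
(a/c), l)` for every choice of the free context binders and Kummer datum. NOT claimed: admissibility / Szpiro-badness / (P6) / non-emptiness. [cite:
Mochizuki2012, IUTchIII Cor. 3.12 Step (xi-f) p. 184; IUTchIV Prop. 1.2 p. 10] [claim: Mochizuki2012, status: disputed] -/
theorem GenuineM.not_pilotKummerCompatHull_frey2753424041748046875_p73_band {l : ℕ} (hl : l.Prime) (hlo : 9 ≤ l) (hhi : l ≤ 12789) (hneP : l ≠ 73)
    (T : Cor22.ThetaVolumeDatumAt (ratPoint (((3 ^ 5 * 5 ^ 15 * 13 ^ 5 : ℕ) : ℚ) / (2 ^ 11 * 73 ^ 7 * 83 ^ 2 * 197 : ℕ))) l) (u : FinitePlace ℚ) (hu : ratChar u = 73) :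
    letI := T.instFieldF; letI := T.instNumberFieldF; letI := T.instAlgebraF; letI := T.instFieldK
    letI := T.instNumberFieldK; letI := T.instAlgebraK; letI := T.instFieldFbar; letI := T.instAlgebraFbar
    letI := T.instAlgebraKFbar; letI := T.instIsElliptic
    ∀ (M : Type) [Field M] [NumberField M]
      (archPk : ∀ (j : (thetaIndexOfInitial T.D).Label) (vQ : (thetaIndexOfInitial T.D).VQ),
        Set ((logShellsOfInitialDH T.D (analyticLogvVal T.K)).Packet j vQ))
      (archSub : ∀ (j : (thetaIndexOfInitial T.D).Label) (v : (thetaIndexOfInitial T.D).V),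
        Set ((logShellsOfInitialDH T.D (analyticLogvVal T.K)).Packet j ((thetaIndexOfInitial T.D).over v)))
      (Ψ : ℤ → ∀ v : (thetaIndexOfInitial T.D).V, v ∈ (thetaIndexOfInitial T.D).Vbad →
        Set ((logShellsOfInitialDH T.D (analyticLogvVal T.K)).StarPacket v))
      (act : ℤ → ∀ v : (thetaIndexOfInitial T.D).V, v ∈ (thetaIndexOfInitial T.D).Vbad →
        (logShellsOfInitialDH T.D (analyticLogvVal T.K)).StarPacket v →
          Module.End ℚ ((logShellsOfInitialDH T.D (analyticLogvVal T.K)).StarPacket v))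
      (Mmod : ℤ → ∀ j : (thetaIndexOfInitial T.D).LabelStar, Set ((logShellsOfInitialDH T.D (analyticLogvVal T.K)).GlobalPacket j.1))
      (region : ℤ → ∀ j : (thetaIndexOfInitial T.D).LabelStar, FinDivisor M → ∀ vQ : (thetaIndexOfInitial T.D).VQ,
        Set ((logShellsOfInitialDH T.D (analyticLogvVal T.K)).Packet j.1 vQ))
      (frobAdm : ℤ → ℤ → ∀ (j : (thetaIndexOfInitial T.D).Label) (vQ : (thetaIndexOfInitial T.D).VQ),
        Set ((logShellsOfInitialDH T.D (analyticLogvVal T.K)).Packet j vQ) → Prop)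
      (frobLogvol : ℤ → ℤ → ∀ (j : (thetaIndexOfInitial T.D).Label) (vQ : (thetaIndexOfInitial T.D).VQ),
        Set ((logShellsOfInitialDH T.D (analyticLogvVal T.K)).Packet j vQ) → ℝ)
      (frobΨ : ℤ → ℤ → ∀ v : (thetaIndexOfInitial T.D).V, v ∈ (thetaIndexOfInitial T.D).Vbad →
        Set ((logShellsOfInitialDH T.D (analyticLogvVal T.K)).StarPacket v))
      (frobMmod : ℤ → ℤ → ∀ j : (thetaIndexOfInitial T.D).LabelStar, Set ((logShellsOfInitialDH T.D (analyticLogvVal T.K)).GlobalPacket j.1))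
      (unitImage : ℤ → ℤ → ℕ → ∀ (j : (thetaIndexOfInitial T.D).Label) (vQ : (thetaIndexOfInitial T.D).VQ),
        Set ((logShellsOfInitialDH T.D (analyticLogvVal T.K)).Packet j vQ))
      (ballImage : ℤ → ℤ → ∀ (j : (thetaIndexOfInitial T.D).Label) (vQ : (thetaIndexOfInitial T.D).VQ),
        Set ((logShellsOfInitialDH T.D (analyticLogvVal T.K)).Packet j vQ))
      (thetaDiv : ℤ → ℤ → LgpDivisor M (thetaIndexOfInitial T.D).lstar)
      (n : ℤ) {HT : Type} {LogLink : HT → HT → Type} {IsFull : ∀ {s t : HT}, LogLink s t → Prop}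
      (lat : LGPGaussianLogThetaLattice LogLink IsFull)
      {Frd : Type} {IsoF : Frd → Frd → Type} {Ob : Frd → Type} {realify : Frd → Frd} {Strip : Type}
      {IsoS : Strip → Strip → Type} {Mv : ∀ v : (thetaIndexOfInitial T.D).V, v ∈ (thetaIndexOfInitial T.D).Vbad → Type}
      [∀ v h, Monoid (Mv v h)]
      (sig : GlobalLGPFrobenioidSignature (thetaIndexOfInitial T.D).lstar (thetaIndexOfInitial T.D).V
        (· ∈ (thetaIndexOfInitial T.D).Vbad) Frd IsoF Ob realify Strip IsoS Mv)
      (split : SplittingMonoids Mv) {ObΔ : Type} {N : ∀ v : (thetaIndexOfInitial T.D).V, v ∈ (thetaIndexOfInitial T.D).Vbad → Type}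
      [∀ v h, Monoid (N v h)] (qData : QPilotData ObΔ N)
      (qK : ∀ v : (thetaIndexOfInitial T.D).V, v ∈ (thetaIndexOfInitial T.D).Vbad →
        Set ((logShellsOfInitialDH T.D (analyticLogvVal T.K)).StarPacket v)),
      ¬ Cor312Vol.PilotKummerCompatHull
        (LatticeSituation.ofShells (logShellsOfInitialDH T.D (analyticLogvVal T.K)) M archPk archSub
          (summandPiecesPrM T.D (logvAnalyticVal_analyticLogvVal (K := T.K))).Adm (summandPiecesPrM T.D (logvAnalyticVal_analyticLogvVal (K := T.K))).logvol Ψ act Mmod region frobAdm frobLogvol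
          frobΨ frobMmod unitImage ballImage thetaDiv)
        (settingPrVolSharpM T.D (logvAnalyticVal_analyticLogvVal (K := T.K)) (tOfIdeleData T.D (ideleDataOf T.D T.isVolumeInputOf))
          (fun u x => tqM T.D (ratChar u) u (natCast_ratChar_mem u) (ideleDataOf T.D T.isVolumeInputOf) x) M archPk archSub Ψ act Mmod region n lat sig split qData
          (fun u x => tqM_ne_zero T.D (ratChar u) u (natCast_ratChar_mem u) (ideleDataOf T.D T.isVolumeInputOf) x)
          (GenuineM.finite_ratPlaces_under_S T.D).toFinset
          (fun u x hu => norm_tqM_eq_one_of_not_mem T.D (ratChar u) u (natCast_ratChar_mem u) (ideleDataOf T.D T.isVolumeInputOf) x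
            fun hx => hu ((Set.Finite.mem_toFinset _).mpr ⟨x, hx⟩)))
        (fun _ => Cor312.Setting.qRegion
          (settingPrVolSharpM T.D (logvAnalyticVal_analyticLogvVal (K := T.K)) (tOfIdeleData T.D (ideleDataOf T.D T.isVolumeInputOf))
          (fun u x => tqM T.D (ratChar u) u (natCast_ratChar_mem u) (ideleDataOf T.D T.isVolumeInputOf) x) M archPk archSub Ψ act Mmod region n lat sig split qData
          (fun u x => tqM_ne_zero T.D (ratChar u) u (natCast_ratChar_mem u) (ideleDataOf T.D T.isVolumeInputOf) x)
          (GenuineM.finite_ratPlaces_under_S T.D).toFinset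
          (fun u x hu => norm_tqM_eq_one_of_not_mem T.D (ratChar u) u (natCast_ratChar_mem u) (ideleDataOf T.D T.isVolumeInputOf) x
            fun hx => hu ((Set.Finite.mem_toFinset _).mpr ⟨x, hx⟩)))) qK := by
  rcases Nat.lt_or_ge l 176 with hlt0 | hge0
  · exact GenuineM.not_pilotKummerCompatHull_triple_of_linUniform_cert isABCTriple_frey2753424041748046875 T u 73 hu (by norm_num) (by norm_num)
      (by norm_num) hneP.symm 1 (by show 30 * l < 73 ^ 1 * (73 - 1); norm_num; omega) 7 (by norm_num) (dvd_mul_of_dvd_right (by norm_num) _) hl (by omega) 9 (by omega)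
      (by norm_num) (by norm_num) (by norm_num)
  exact GenuineM.not_pilotKummerCompatHull_triple_of_linUniform_cert isABCTriple_frey2753424041748046875 T u 73 hu (by norm_num) (by norm_num)
      (by norm_num) hneP.symm 2 (by show 30 * l < 73 ^ 2 * (73 - 1); norm_num; omega) 7 (by norm_num) (dvd_mul_of_dvd_right (by norm_num) _) hl (by omega) 26 (by omega)
      (by norm_num) (by norm_num) (by norm_num)

/-- **M LINE — R-W ROWS `pilotDataOfK:frey-115966796875-9301344999072-9417311795947:l` for EVERY prime `7 ≤ l ≤ 3361` with `l ≠ 7` — REFUTED side at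
the M setting, unconditionally, BY ONE BAND THEOREM** (M twin of `GenuineK.not_pilotKummerCompatHull_chosen_frey115966796875_band`; deciding place `u`
over `p = 7`) (block F3 of the R-W numerics lead's WINDOW-TABLE: 73 tabulated Szpiro-bad admissible `l` of this triple, `11 ≤ l ≤ 397`): triple `5 ^
14 * 19 + 2 ^ 5 * 3 * 7 ^ 13 = 11 ^ 7 * 37 ^ 2 * 353`; deciding prime `p = 7` (`7^13 ∣ abc`, `p ∤ 30`), bands `B = 2` for `l ≤ 9` (certificate `l₀ =
7`); `B = 3` for `l ≤ 68` (certificate `l₀ = 10`); `B = 4` for `l ≤ 480` (certificate `l₀ = 17`); `B = 5` for `l ≤ 3361` (certificate `l₀ = 72`); `l =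
7` excluded (`p = l` is outside the decider): at the label `j = l⋆ = (l−1)/2` the [LIN]-uniform test of p464182 holds throughout the band (quadratic
certificate `LinUniformBand.test_of_cert`), so the hull-level clause S_H FAILS at the summand-route M-level sharp setting of the OWN read-off ideles
(pinned reading) of every genuine Θ-volume datum over `(ratPoint (a/c), l)` for every choice of the free context binders and Kummer datum. NOT
claimed: admissibility / Szpiro-badness / (P6) / non-emptiness. [cite: Mochizuki2012, IUTchIII Cor. 3.12 Step (xi-f) p. 184; IUTchIV Prop. 1.2 p. 10]
[claim: Mochizuki2012, status: disputed] -/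
theorem GenuineM.not_pilotKummerCompatHull_frey115966796875_p7_band {l : ℕ} (hl : l.Prime) (hlo : 7 ≤ l) (hhi : l ≤ 3361) (hneP : l ≠ 7)
    (T : Cor22.ThetaVolumeDatumAt (ratPoint (((5 ^ 14 * 19 : ℕ) : ℚ) / (11 ^ 7 * 37 ^ 2 * 353 : ℕ))) l) (u : FinitePlace ℚ) (hu : ratChar u = 7) :
    letI := T.instFieldF; letI := T.instNumberFieldF; letI := T.instAlgebraF; letI := T.instFieldK
    letI := T.instNumberFieldK; letI := T.instAlgebraK; letI := T.instFieldFbar; letI := T.instAlgebraFbar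
    letI := T.instAlgebraKFbar; letI := T.instIsElliptic
    ∀ (M : Type) [Field M] [NumberField M]
      (archPk : ∀ (j : (thetaIndexOfInitial T.D).Label) (vQ : (thetaIndexOfInitial T.D).VQ),
        Set ((logShellsOfInitialDH T.D (analyticLogvVal T.K)).Packet j vQ))
      (archSub : ∀ (j : (thetaIndexOfInitial T.D).Label) (v : (thetaIndexOfInitial T.D).V),
        Set ((logShellsOfInitialDH T.D (analyticLogvVal T.K)).Packet j ((thetaIndexOfInitial T.D).over v)))
      (Ψ : ℤ → ∀ v : (thetaIndexOfInitial T.D).V, v ∈ (thetaIndexOfInitial T.D).Vbad →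
        Set ((logShellsOfInitialDH T.D (analyticLogvVal T.K)).StarPacket v))
      (act : ℤ → ∀ v : (thetaIndexOfInitial T.D).V, v ∈ (thetaIndexOfInitial T.D).Vbad →
        (logShellsOfInitialDH T.D (analyticLogvVal T.K)).StarPacket v →
          Module.End ℚ ((logShellsOfInitialDH T.D (analyticLogvVal T.K)).StarPacket v))
      (Mmod : ℤ → ∀ j : (thetaIndexOfInitial T.D).LabelStar, Set ((logShellsOfInitialDH T.D (analyticLogvVal T.K)).GlobalPacket j.1))
      (region : ℤ → ∀ j : (thetaIndexOfInitial T.D).LabelStar, FinDivisor M → ∀ vQ : (thetaIndexOfInitial T.D).VQ,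
        Set ((logShellsOfInitialDH T.D (analyticLogvVal T.K)).Packet j.1 vQ))
      (frobAdm : ℤ → ℤ → ∀ (j : (thetaIndexOfInitial T.D).Label) (vQ : (thetaIndexOfInitial T.D).VQ),
        Set ((logShellsOfInitialDH T.D (analyticLogvVal T.K)).Packet j vQ) → Prop)
      (frobLogvol : ℤ → ℤ → ∀ (j : (thetaIndexOfInitial T.D).Label) (vQ : (thetaIndexOfInitial T.D).VQ),
        Set ((logShellsOfInitialDH T.D (analyticLogvVal T.K)).Packet j vQ) → ℝ)
      (frobΨ : ℤ → ℤ → ∀ v : (thetaIndexOfInitial T.D).V, v ∈ (thetaIndexOfInitial T.D).Vbad →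
        Set ((logShellsOfInitialDH T.D (analyticLogvVal T.K)).StarPacket v))
      (frobMmod : ℤ → ℤ → ∀ j : (thetaIndexOfInitial T.D).LabelStar, Set ((logShellsOfInitialDH T.D (analyticLogvVal T.K)).GlobalPacket j.1))
      (unitImage : ℤ → ℤ → ℕ → ∀ (j : (thetaIndexOfInitial T.D).Label) (vQ : (thetaIndexOfInitial T.D).VQ),
        Set ((logShellsOfInitialDH T.D (analyticLogvVal T.K)).Packet j vQ))
      (ballImage : ℤ → ℤ → ∀ (j : (thetaIndexOfInitial T.D).Label) (vQ : (thetaIndexOfInitial T.D).VQ),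
        Set ((logShellsOfInitialDH T.D (analyticLogvVal T.K)).Packet j vQ))
      (thetaDiv : ℤ → ℤ → LgpDivisor M (thetaIndexOfInitial T.D).lstar)
      (n : ℤ) {HT : Type} {LogLink : HT → HT → Type} {IsFull : ∀ {s t : HT}, LogLink s t → Prop}
      (lat : LGPGaussianLogThetaLattice LogLink IsFull)
      {Frd : Type} {IsoF : Frd → Frd → Type} {Ob : Frd → Type} {realify : Frd → Frd} {Strip : Type}
      {IsoS : Strip → Strip → Type} {Mv : ∀ v : (thetaIndexOfInitial T.D).V, v ∈ (thetaIndexOfInitial T.D).Vbad → Type}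
      [∀ v h, Monoid (Mv v h)]
      (sig : GlobalLGPFrobenioidSignature (thetaIndexOfInitial T.D).lstar (thetaIndexOfInitial T.D).V
        (· ∈ (thetaIndexOfInitial T.D).Vbad) Frd IsoF Ob realify Strip IsoS Mv)
      (split : SplittingMonoids Mv) {ObΔ : Type} {N : ∀ v : (thetaIndexOfInitial T.D).V, v ∈ (thetaIndexOfInitial T.D).Vbad → Type}
      [∀ v h, Monoid (N v h)] (qData : QPilotData ObΔ N)
      (qK : ∀ v : (thetaIndexOfInitial T.D).V, v ∈ (thetaIndexOfInitial T.D).Vbad →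
        Set ((logShellsOfInitialDH T.D (analyticLogvVal T.K)).StarPacket v)),
      ¬ Cor312Vol.PilotKummerCompatHull
        (LatticeSituation.ofShells (logShellsOfInitialDH T.D (analyticLogvVal T.K)) M archPk archSub
          (summandPiecesPrM T.D (logvAnalyticVal_analyticLogvVal (K := T.K))).Adm (summandPiecesPrM T.D (logvAnalyticVal_analyticLogvVal (K := T.K))).logvol Ψ act Mmod region frobAdm frobLogvol
          frobΨ frobMmod unitImage ballImage thetaDiv)
        (settingPrVolSharpM T.D (logvAnalyticVal_analyticLogvVal (K := T.K)) (tOfIdeleData T.D (ideleDataOf T.D T.isVolumeInputOf))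
          (fun u x => tqM T.D (ratChar u) u (natCast_ratChar_mem u) (ideleDataOf T.D T.isVolumeInputOf) x) M archPk archSub Ψ act Mmod region n lat sig split qData
          (fun u x => tqM_ne_zero T.D (ratChar u) u (natCast_ratChar_mem u) (ideleDataOf T.D T.isVolumeInputOf) x)
          (GenuineM.finite_ratPlaces_under_S T.D).toFinset
          (fun u x hu => norm_tqM_eq_one_of_not_mem T.D (ratChar u) u (natCast_ratChar_mem u) (ideleDataOf T.D T.isVolumeInputOf) x
            fun hx => hu ((Set.Finite.mem_toFinset _).mpr ⟨x, hx⟩)))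
        (fun _ => Cor312.Setting.qRegion
          (settingPrVolSharpM T.D (logvAnalyticVal_analyticLogvVal (K := T.K)) (tOfIdeleData T.D (ideleDataOf T.D T.isVolumeInputOf))
          (fun u x => tqM T.D (ratChar u) u (natCast_ratChar_mem u) (ideleDataOf T.D T.isVolumeInputOf) x) M archPk archSub Ψ act Mmod region n lat sig split qData
          (fun u x => tqM_ne_zero T.D (ratChar u) u (natCast_ratChar_mem u) (ideleDataOf T.D T.isVolumeInputOf) x)
          (GenuineM.finite_ratPlaces_under_S T.D).toFinset
          (fun u x hu => norm_tqM_eq_one_of_not_mem T.D (ratChar u) u (natCast_ratChar_mem u) (ideleDataOf T.D T.isVolumeInputOf) x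
            fun hx => hu ((Set.Finite.mem_toFinset _).mpr ⟨x, hx⟩)))) qK := by
  rcases Nat.lt_or_ge l 10 with hlt0 | hge0
  · exact GenuineM.not_pilotKummerCompatHull_triple_of_linUniform_cert isABCTriple_frey115966796875 T u 7 hu (by norm_num) (by norm_num)
      (by norm_num) hneP.symm 2 (by show 30 * l < 7 ^ 2 * (7 - 1); norm_num; omega) 13 (by norm_num) (dvd_mul_of_dvd_left (dvd_mul_of_dvd_right (by norm_num) _) _) hl (by omega) 7 (by omega)
      (by norm_num) (by norm_num) (by norm_num)
  rcases Nat.lt_or_ge l 69 with hlt1 | hge1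
  · exact GenuineM.not_pilotKummerCompatHull_triple_of_linUniform_cert isABCTriple_frey115966796875 T u 7 hu (by norm_num) (by norm_num)
      (by norm_num) hneP.symm 3 (by show 30 * l < 7 ^ 3 * (7 - 1); norm_num; omega) 13 (by norm_num) (dvd_mul_of_dvd_left (dvd_mul_of_dvd_right (by norm_num) _) _) hl (by omega) 10 (by omega)
      (by norm_num) (by norm_num) (by norm_num)
  rcases Nat.lt_or_ge l 481 with hlt2 | hge2
  · exact GenuineM.not_pilotKummerCompatHull_triple_of_linUniform_cert isABCTriple_frey115966796875 T u 7 hu (by norm_num) (by norm_num)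
      (by norm_num) hneP.symm 4 (by show 30 * l < 7 ^ 4 * (7 - 1); norm_num; omega) 13 (by norm_num) (dvd_mul_of_dvd_left (dvd_mul_of_dvd_right (by norm_num) _) _) hl (by omega) 17 (by omega)
      (by norm_num) (by norm_num) (by norm_num)
  exact GenuineM.not_pilotKummerCompatHull_triple_of_linUniform_cert isABCTriple_frey115966796875 T u 7 hu (by norm_num) (by norm_num)
      (by norm_num) hneP.symm 5 (by show 30 * l < 7 ^ 5 * (7 - 1); norm_num; omega) 13 (by norm_num) (dvd_mul_of_dvd_left (dvd_mul_of_dvd_right (by norm_num) _) _) hl (by omega) 72 (by omega)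
      (by norm_num) (by norm_num) (by norm_num)

end Summit.ABC.IUTFork.Conditional

end
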